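import Mathlib.Analysis.Complex.Basic
import Mathlib.Data.Matrix.Basis
import Mathlib.LinearAlgebra.Matrix.ConjTranspose
import Mathlib.Tactic.Module
import Mathlib.Tactic.LinearCombination
import HarnessLib

/-!
# Root vectors of the real unitary Lie algebras `𝔲(diag e) ⊆ 𝔤𝔩_N(ℂ)` in matrix units, and their jets at a torus point with REAL coefficients (Varadarajan 1989 §6.3; Hall GTM 222 §3.6)

Topic `NumberTheory/Automorphic`; namespace `Literature.NumberTheory.Automorphic.RootVectors`.  THEOREMS ONLY (no `def`, no instance, no notation, no axiom, no named fact, no `sorry`).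
Cell `pub/hodgecm-mathlib`, ENGINE T1 (crux H413 = `stmt-HodgeConjecture-24833`); ROAD A owner word 2026-09-01T12:22:33Z (o2′) «the RANK-2 CASIMIR RADIAL EQUATION on the compact Cartan of
`U(2,1)`» (census `CENSUS-Rank2CasimirRadialEquation.A-p18g26.md` bac477e2), FILE A1 (pure algebra, every `N`): the rank-one file ★ `ArchRankOneCasimirTorusPoint` §1∕§3 for an arbitrary
pair of indices `i ≠ j`, written with `Matrix.single` so that no `fin_cases` is needed.  Author A-p18 (g26), 2026-09-01.

THE MATHEMATICS (`E_kl = Matrix.single k l 1`, `P = E_ii + E_jj`, `H_ij = i•E_ii − i•E_jj`, reals `p, q` with `pq = 1`, `H = diag e`).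
* NONCOMPACT root (`q²e_j = −e_i`, so `e_ie_j < 0`): `X̂ = pE_ij + qE_ji`, `Ŷ = −ipE_ij + iqE_ji`; `X̂² = Ŷ² = P`, `X̂Ŷ = H_ij = −ŶX̂`; `X̂ᴴH = −HX̂`, `ŶᴴH = −HŶ`.
* COMPACT root (`q²e_j = e_i`, so `e_ie_j > 0`): `X = pE_ij − qE_ji`, `Y = ipE_ij + iqE_ji`; `X² = Y² = −P`, `XY = H_ij = −YX`; `XᴴH = −HX`, `YᴴH = −HY`.
* TORUS POINT `γ = diag ζ` with `ζ_j = (C − Si)ζ_i`, `ζ_i = (C + Si)ζ_j` (`C = cos φ`, `S = sin φ`, `φ = θ_i − θ_j`): `X̂γ − γX̂ = (C−1)•γX̂ + S•γŶ`, `Ŷγ − γŶ = (−S)•γX̂ + (C−1)•γŶ`,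
  `Pγ + γP − 2•X̂γX̂ = (2−2C)•γP + (2S)•γH_ij` (noncompact); `Xγ − γX = (C−1)•γX + (−S)•γY`, `Yγ − γY = S•γX + (C−1)•γY`, `−(Pγ + γP) − 2•XγX = (2−2C)•(−γP) + (2(−S))•γH_ij` (compact)
  — the hypotheses `h₂ h₃ hc` of ★ Z1 `sum_boost_jets_eq` with `(U, W, γ′, Y′) = (γX̂, γŶ, ±γP, γH_ij)` and `S′ = ±S`.
HONEST LABEL: elementary matrix algebra; pays nothing by itself (HC_CM is proved only modulo the printed citations until rung 0 closes).

## References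
* [Varadarajan1989] V. S. Varadarajan, *An Introduction to Harmonic Analysis on Semisimple Lie Groups* (1989), §6.3.
* [Hall2015] B. C. Hall, *Lie Groups, Lie Algebras, and Representations*, 2nd ed., GTM 222 (2015), §3.6.
-/

set_option autoImplicit false

namespace Literature.NumberTheory.Automorphic.RootVectors

open Complex Matrix
open scoped ComplexConjugate

variable {N : ℕ}

/-! ## §1 Matrix units against a diagonal -/

/-- `diag ζ · E_ij = ζ_i • E_ij`. [cite: Hall2015, §3.6] -/
theorem diagonal_mul_single (ζ : Fin N → ℂ) (i j : Fin N) : Matrix.diagonal ζ * Matrix.single i j (1 : ℂ) = ζ i • Matrix.single i j (1 : ℂ) := by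
  ext a b
  simp only [Matrix.diagonal_mul, Matrix.smul_apply, Matrix.single, Matrix.of_apply, smul_eq_mul]
  split_ifs with h
  · rw [h.1]
  · simp

/-- `E_ij · diag ζ = ζ_j • E_ij`. [cite: Hall2015, §3.6] -/
theorem single_mul_diagonal (ζ : Fin N → ℂ) (i j : Fin N) : Matrix.single i j (1 : ℂ) * Matrix.diagonal ζ = ζ j • Matrix.single i j (1 : ℂ) := by
  ext a b
  simp only [Matrix.mul_diagonal, Matrix.smul_apply, Matrix.single, Matrix.of_apply, smul_eq_mul]
  split_ifs with h
  · rw [h.2, mul_comm]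
  · simp

/-- `(c•E_ij)ᴴ = c̄•E_ji`. [cite: Hall2015, §3.6] -/
theorem star_smul_single (i j : Fin N) (c : ℂ) : star (c • Matrix.single i j (1 : ℂ)) = conj c • Matrix.single j i (1 : ℂ) := by
  rw [star_smul, Matrix.star_eq_conjTranspose, Matrix.conjTranspose_single, star_one, Complex.star_def]

/-- A two-term combination of matrix units against a diagonal on the right and on the left. [cite: Hall2015, §3.6] -/
theorem smul_single_add_smul_single_mul_diagonal (ζ : Fin N → ℂ) (i j : Fin N) (a b : ℂ) :
    (a • Matrix.single i j (1 : ℂ) + b • Matrix.single j i (1 : ℂ)) * Matrix.diagonal ζ = (a * ζ j) • Matrix.single i j (1 : ℂ) + (b * ζ i) • Matrix.single j i (1 : ℂ) ∧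
    Matrix.diagonal ζ * (a • Matrix.single i j (1 : ℂ) + b • Matrix.single j i (1 : ℂ)) = (a * ζ i) • Matrix.single i j (1 : ℂ) + (b * ζ j) • Matrix.single j i (1 : ℂ) := by
  constructor
  · rw [add_mul, Matrix.smul_mul, Matrix.smul_mul, single_mul_diagonal, single_mul_diagonal, smul_smul, smul_smul]
  · rw [mul_add, Matrix.mul_smul, Matrix.mul_smul, diagonal_mul_single, diagonal_mul_single, smul_smul, smul_smul, mul_comm a, mul_comm b]

/-! ## §2 The noncompact root `X̂ = pE_ij + qE_ji`, `Ŷ = −ipE_ij + iqE_ji` -/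

section Noncompact

variable (i j : Fin N) (hij : i ≠ j) {p q : ℝ} (hpq : p * q = 1)
include hij hpq

/-- `X̂² = P`. [cite: Hall2015, §3.6] -/
theorem Xh_mul_Xh : ((p : ℂ) • Matrix.single i j (1 : ℂ) + (q : ℂ) • Matrix.single j i (1 : ℂ)) * ((p : ℂ) • Matrix.single i j (1 : ℂ) + (q : ℂ) • Matrix.single j i (1 : ℂ)) =
    Matrix.single i i (1 : ℂ) + Matrix.single j j (1 : ℂ) := by
  have h : (p : ℂ) * q = 1 := by exact_mod_cast hpq
  simp only [add_mul, mul_add, Matrix.smul_mul, Matrix.mul_smul, smul_smul, Matrix.single_mul_single_same, Matrix.single_mul_single_of_ne, hij, hij.symm,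
    ne_eq, not_false_eq_true, smul_zero, add_zero, zero_add, mul_one]
  linear_combination (norm := module) h • Matrix.single i i (1 : ℂ) + h • Matrix.single j j (1 : ℂ)

/-- `Ŷ² = P`. [cite: Hall2015, §3.6] -/
theorem Yh_mul_Yh : ((-((p : ℂ) * I)) • Matrix.single i j (1 : ℂ) + ((q : ℂ) * I) • Matrix.single j i (1 : ℂ)) * ((-((p : ℂ) * I)) • Matrix.single i j (1 : ℂ) + ((q : ℂ) * I) • Matrix.single j i (1 : ℂ)) =
    Matrix.single i i (1 : ℂ) + Matrix.single j j (1 : ℂ) := by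
  have h : (p : ℂ) * q = 1 := by exact_mod_cast hpq
  simp only [add_mul, mul_add, Matrix.smul_mul, Matrix.mul_smul, smul_smul, Matrix.single_mul_single_same, Matrix.single_mul_single_of_ne, hij, hij.symm,
    ne_eq, not_false_eq_true, smul_zero, add_zero, zero_add, mul_one]
  linear_combination (norm := module) ((-((p : ℂ) * q)) • I_sq + h) • Matrix.single j j (1 : ℂ) + ((-((p : ℂ) * q)) • I_sq + h) • Matrix.single i i (1 : ℂ)

/-- `X̂Ŷ = H_ij = i•E_ii − i•E_jj`. [cite: Hall2015, §3.6] -/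
theorem Xh_mul_Yh : ((p : ℂ) • Matrix.single i j (1 : ℂ) + (q : ℂ) • Matrix.single j i (1 : ℂ)) * ((-((p : ℂ) * I)) • Matrix.single i j (1 : ℂ) + ((q : ℂ) * I) • Matrix.single j i (1 : ℂ)) =
    I • Matrix.single i i (1 : ℂ) - I • Matrix.single j j (1 : ℂ) := by
  have h : (p : ℂ) * q = 1 := by exact_mod_cast hpq
  simp only [add_mul, mul_add, Matrix.smul_mul, Matrix.mul_smul, smul_smul, Matrix.single_mul_single_same, Matrix.single_mul_single_of_ne, hij, hij.symm,
    ne_eq, not_false_eq_true, smul_zero, add_zero, zero_add, mul_one]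
  linear_combination (norm := module) (I * h) • Matrix.single i i (1 : ℂ) - (I * h) • Matrix.single j j (1 : ℂ)

/-- `ŶX̂ = −H_ij`. [cite: Hall2015, §3.6] -/
theorem Yh_mul_Xh : ((-((p : ℂ) * I)) • Matrix.single i j (1 : ℂ) + ((q : ℂ) * I) • Matrix.single j i (1 : ℂ)) * ((p : ℂ) • Matrix.single i j (1 : ℂ) + (q : ℂ) • Matrix.single j i (1 : ℂ)) =
    -(I • Matrix.single i i (1 : ℂ) - I • Matrix.single j j (1 : ℂ)) := by
  have h : (p : ℂ) * q = 1 := by exact_mod_cast hpq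
  simp only [add_mul, mul_add, Matrix.smul_mul, Matrix.mul_smul, smul_smul, Matrix.single_mul_single_same, Matrix.single_mul_single_of_ne, hij, hij.symm,
    ne_eq, not_false_eq_true, smul_zero, add_zero, zero_add, mul_one]
  linear_combination (norm := module) (-(I * h)) • Matrix.single i i (1 : ℂ) + (I * h) • Matrix.single j j (1 : ℂ)

omit hij hpq in
/-- `X̂ ∈ 𝔲(diag e)`: `X̂ᴴ·diag e = −diag e·X̂` when `pq = 1`, `q²e_j = −e_i`. [cite: Hall2015, §3.6] -/
theorem star_Xh_mul_diagonal (hpq : p * q = 1) (e : Fin N → ℂ) (hqe : (q : ℂ) ^ 2 * e j = -e i) :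
    star ((p : ℂ) • Matrix.single i j (1 : ℂ) + (q : ℂ) • Matrix.single j i (1 : ℂ)) * Matrix.diagonal e =
      -(Matrix.diagonal e * ((p : ℂ) • Matrix.single i j (1 : ℂ) + (q : ℂ) • Matrix.single j i (1 : ℂ))) := by
  have h : (p : ℂ) * q = 1 := by exact_mod_cast hpq
  rw [star_add, star_smul_single, star_smul_single, Complex.conj_ofReal, Complex.conj_ofReal, add_comm,
    (smul_single_add_smul_single_mul_diagonal e i j (q : ℂ) (p : ℂ)).1, (smul_single_add_smul_single_mul_diagonal e i j (p : ℂ) (q : ℂ)).2]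
  linear_combination (norm := module) ((p : ℂ) • hqe - ((q : ℂ) * e j) • h) • Matrix.single i j (1 : ℂ) + ((p : ℂ) • hqe - ((q : ℂ) * e j) • h) • Matrix.single j i (1 : ℂ)

omit hij hpq in
/-- `Ŷ ∈ 𝔲(diag e)`: `Ŷᴴ·diag e = −diag e·Ŷ` when `pq = 1`, `q²e_j = −e_i`. [cite: Hall2015, §3.6] -/
theorem star_Yh_mul_diagonal (hpq : p * q = 1) (e : Fin N → ℂ) (hqe : (q : ℂ) ^ 2 * e j = -e i) :
    star ((-((p : ℂ) * I)) • Matrix.single i j (1 : ℂ) + ((q : ℂ) * I) • Matrix.single j i (1 : ℂ)) * Matrix.diagonal e =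
      -(Matrix.diagonal e * ((-((p : ℂ) * I)) • Matrix.single i j (1 : ℂ) + ((q : ℂ) * I) • Matrix.single j i (1 : ℂ))) := by
  have h : (p : ℂ) * q = 1 := by exact_mod_cast hpq
  have hcI : conj I = -I := Complex.conj_I
  rw [star_add, star_smul_single, star_smul_single, map_neg, map_mul, map_mul, Complex.conj_ofReal, Complex.conj_ofReal, hcI, add_comm,
    (smul_single_add_smul_single_mul_diagonal e i j _ _).1, (smul_single_add_smul_single_mul_diagonal e i j _ _).2]
  linear_combination (norm := module) ((-(p : ℂ) * I) • hqe + ((q : ℂ) * e j * I) • h) • Matrix.single i j (1 : ℂ) +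
    (((p : ℂ) * I) • hqe - ((q : ℂ) * e j * I) • h) • Matrix.single j i (1 : ℂ)

end Noncompact

/-! ## §3 The compact root `X = pE_ij − qE_ji`, `Y = ipE_ij + iqE_ji` -/

section Compact

variable (i j : Fin N) (hij : i ≠ j) {p q : ℝ} (hpq : p * q = 1)
include hij hpq

/-- `X² = −P`. [cite: Hall2015, §3.6] -/
theorem Xc_mul_Xc : ((p : ℂ) • Matrix.single i j (1 : ℂ) - (q : ℂ) • Matrix.single j i (1 : ℂ)) * ((p : ℂ) • Matrix.single i j (1 : ℂ) - (q : ℂ) • Matrix.single j i (1 : ℂ)) =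
    -(Matrix.single i i (1 : ℂ) + Matrix.single j j (1 : ℂ)) := by
  have h : (p : ℂ) * q = 1 := by exact_mod_cast hpq
  simp only [sub_mul, mul_sub, Matrix.smul_mul, Matrix.mul_smul, smul_smul, Matrix.single_mul_single_same, Matrix.single_mul_single_of_ne, hij, hij.symm,
    ne_eq, not_false_eq_true, smul_zero, sub_zero, zero_sub, mul_one]
  linear_combination (norm := module) (-h) • Matrix.single i i (1 : ℂ) - h • Matrix.single j j (1 : ℂ)

/-- `Y² = −P`. [cite: Hall2015, §3.6] -/
theorem Yc_mul_Yc : (((p : ℂ) * I) • Matrix.single i j (1 : ℂ) + ((q : ℂ) * I) • Matrix.single j i (1 : ℂ)) * (((p : ℂ) * I) • Matrix.single i j (1 : ℂ) + ((q : ℂ) * I) • Matrix.single j i (1 : ℂ)) =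
    -(Matrix.single i i (1 : ℂ) + Matrix.single j j (1 : ℂ)) := by
  have h : (p : ℂ) * q = 1 := by exact_mod_cast hpq
  simp only [add_mul, mul_add, Matrix.smul_mul, Matrix.mul_smul, smul_smul, Matrix.single_mul_single_same, Matrix.single_mul_single_of_ne, hij, hij.symm,
    ne_eq, not_false_eq_true, smul_zero, add_zero, zero_add, mul_one]
  linear_combination (norm := module) (((p : ℂ) * q) • I_sq - h) • Matrix.single i i (1 : ℂ) + (((p : ℂ) * q) • I_sq - h) • Matrix.single j j (1 : ℂ)

/-- `XY = H_ij`. [cite: Hall2015, §3.6] -/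
theorem Xc_mul_Yc : ((p : ℂ) • Matrix.single i j (1 : ℂ) - (q : ℂ) • Matrix.single j i (1 : ℂ)) * (((p : ℂ) * I) • Matrix.single i j (1 : ℂ) + ((q : ℂ) * I) • Matrix.single j i (1 : ℂ)) =
    I • Matrix.single i i (1 : ℂ) - I • Matrix.single j j (1 : ℂ) := by
  have h : (p : ℂ) * q = 1 := by exact_mod_cast hpq
  simp only [sub_mul, mul_add, Matrix.smul_mul, Matrix.mul_smul, smul_smul, Matrix.single_mul_single_same, Matrix.single_mul_single_of_ne, hij, hij.symm,
    ne_eq, not_false_eq_true, smul_zero, mul_one]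
  linear_combination (norm := module) (I * h) • Matrix.single i i (1 : ℂ) - (I * h) • Matrix.single j j (1 : ℂ)

/-- `YX = −H_ij`. [cite: Hall2015, §3.6] -/
theorem Yc_mul_Xc : (((p : ℂ) * I) • Matrix.single i j (1 : ℂ) + ((q : ℂ) * I) • Matrix.single j i (1 : ℂ)) * ((p : ℂ) • Matrix.single i j (1 : ℂ) - (q : ℂ) • Matrix.single j i (1 : ℂ)) =
    -(I • Matrix.single i i (1 : ℂ) - I • Matrix.single j j (1 : ℂ)) := by
  have h : (p : ℂ) * q = 1 := by exact_mod_cast hpq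
  simp only [add_mul, mul_sub, Matrix.smul_mul, Matrix.mul_smul, smul_smul, Matrix.single_mul_single_same, Matrix.single_mul_single_of_ne, hij, hij.symm,
    ne_eq, not_false_eq_true, smul_zero, mul_one]
  linear_combination (norm := module) (-(I * h)) • Matrix.single i i (1 : ℂ) + (I * h) • Matrix.single j j (1 : ℂ)

omit hij hpq in
/-- `X ∈ 𝔲(diag e)`: `Xᴴ·diag e = −diag e·X` when `pq = 1`, `q²e_j = e_i`. [cite: Hall2015, §3.6] -/
theorem star_Xc_mul_diagonal (hpq : p * q = 1) (e : Fin N → ℂ) (hqe : (q : ℂ) ^ 2 * e j = e i) :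
    star ((p : ℂ) • Matrix.single i j (1 : ℂ) - (q : ℂ) • Matrix.single j i (1 : ℂ)) * Matrix.diagonal e =
      -(Matrix.diagonal e * ((p : ℂ) • Matrix.single i j (1 : ℂ) - (q : ℂ) • Matrix.single j i (1 : ℂ))) := by
  have h : (p : ℂ) * q = 1 := by exact_mod_cast hpq
  rw [sub_eq_add_neg, ← neg_smul, star_add, star_smul_single, star_smul_single, map_neg, Complex.conj_ofReal, Complex.conj_ofReal, add_comm,
    (smul_single_add_smul_single_mul_diagonal e i j _ _).1, (smul_single_add_smul_single_mul_diagonal e i j _ _).2]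
  linear_combination (norm := module) ((-(p : ℂ)) • hqe + ((q : ℂ) * e j) • h) • Matrix.single i j (1 : ℂ) + ((-(p : ℂ)) • hqe + ((q : ℂ) * e j) • h) • Matrix.single j i (1 : ℂ)

omit hij hpq in
/-- `Y ∈ 𝔲(diag e)`: `Yᴴ·diag e = −diag e·Y` when `pq = 1`, `q²e_j = e_i`. [cite: Hall2015, §3.6] -/
theorem star_Yc_mul_diagonal (hpq : p * q = 1) (e : Fin N → ℂ) (hqe : (q : ℂ) ^ 2 * e j = e i) :
    star (((p : ℂ) * I) • Matrix.single i j (1 : ℂ) + ((q : ℂ) * I) • Matrix.single j i (1 : ℂ)) * Matrix.diagonal e =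
      -(Matrix.diagonal e * (((p : ℂ) * I) • Matrix.single i j (1 : ℂ) + ((q : ℂ) * I) • Matrix.single j i (1 : ℂ))) := by
  have h : (p : ℂ) * q = 1 := by exact_mod_cast hpq
  have hcI : conj I = -I := Complex.conj_I
  rw [star_add, star_smul_single, star_smul_single, map_mul, map_mul, Complex.conj_ofReal, Complex.conj_ofReal, hcI, add_comm,
    (smul_single_add_smul_single_mul_diagonal e i j _ _).1, (smul_single_add_smul_single_mul_diagonal e i j _ _).2]
  linear_combination (norm := module) ((-(p : ℂ) * I) • hqe + ((q : ℂ) * e j * I) • h) • Matrix.single i j (1 : ℂ) +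
    (((p : ℂ) * I) • hqe - ((q : ℂ) * e j * I) • h) • Matrix.single j i (1 : ℂ)

end Compact

/-! ## §4 The torus point `γ = diag ζ`, `ζ_j = (C − Si)ζ_i`, `ζ_i = (C + Si)ζ_j`: the jets `[X, γ]`, `±(Pγ + γP) − 2XγX` as REAL combinations -/

section Torus

variable (i j : Fin N) (hij : i ≠ j) {p q : ℝ} (hpq : p * q = 1) (ζ : Fin N → ℂ) {C S : ℝ}
  (hb : ζ j = ((C : ℂ) - (S : ℂ) * I) * ζ i) (ha : ζ i = ((C : ℂ) + (S : ℂ) * I) * ζ j)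
include hb ha

/-- NONCOMPACT: `X̂γ − γX̂ = (C−1)•γX̂ + S•γŶ`. [cite: Varadarajan1989, §6.3] -/
theorem Xh_mul_diagonal_sub : ((p : ℂ) • Matrix.single i j (1 : ℂ) + (q : ℂ) • Matrix.single j i (1 : ℂ)) * Matrix.diagonal ζ - Matrix.diagonal ζ * ((p : ℂ) • Matrix.single i j (1 : ℂ) + (q : ℂ) • Matrix.single j i (1 : ℂ)) = (C - 1) • (Matrix.diagonal ζ * ((p : ℂ) • Matrix.single i j (1 : ℂ) + (q : ℂ) • Matrix.single j i (1 : ℂ))) + S • (Matrix.diagonal ζ * ((-((p : ℂ) * I)) • Matrix.single i j (1 : ℂ) + ((q : ℂ) * I) • Matrix.single j i (1 : ℂ))) := by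
  simp only [add_mul, mul_add, Matrix.smul_mul, Matrix.mul_smul, smul_smul, single_mul_diagonal, diagonal_mul_single]
  linear_combination (norm := module) ((p : ℂ) • hb) • Matrix.single i j (1 : ℂ) + ((q : ℂ) • ha) • Matrix.single j i (1 : ℂ)

/-- NONCOMPACT: `Ŷγ − γŶ = (−S)•γX̂ + (C−1)•γŶ`. [cite: Varadarajan1989, §6.3] -/
theorem Yh_mul_diagonal_sub : ((-((p : ℂ) * I)) • Matrix.single i j (1 : ℂ) + ((q : ℂ) * I) • Matrix.single j i (1 : ℂ)) * Matrix.diagonal ζ - Matrix.diagonal ζ * ((-((p : ℂ) * I)) • Matrix.single i j (1 : ℂ) + ((q : ℂ) * I) • Matrix.single j i (1 : ℂ)) = (-S) • (Matrix.diagonal ζ * ((p : ℂ) • Matrix.single i j (1 : ℂ) + (q : ℂ) • Matrix.single j i (1 : ℂ))) + (C - 1) • (Matrix.diagonal ζ * ((-((p : ℂ) * I)) • Matrix.single i j (1 : ℂ) + ((q : ℂ) * I) • Matrix.single j i (1 : ℂ))) := by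
  simp only [add_mul, mul_add, Matrix.smul_mul, Matrix.mul_smul, smul_smul, single_mul_diagonal, diagonal_mul_single]
  linear_combination (norm := module) ((-(p : ℂ) * I) • hb + ((p : ℂ) * ζ i * (S : ℂ)) • I_sq) • Matrix.single i j (1 : ℂ) + (((q : ℂ) * I) • ha + ((q : ℂ) * ζ j * (S : ℂ)) • I_sq) • Matrix.single j i (1 : ℂ)

omit hb ha in
include hij hpq hb ha in
/-- NONCOMPACT: `Pγ + γP − 2•X̂γX̂ = (2−2C)•γP + (2S)•γH_ij` (`pq = 1`). [cite: Varadarajan1989, §6.3] -/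
theorem boostJet_two_eq : (Matrix.single i i (1 : ℂ) + Matrix.single j j (1 : ℂ)) * Matrix.diagonal ζ + Matrix.diagonal ζ * (Matrix.single i i (1 : ℂ) + Matrix.single j j (1 : ℂ)) - (2 : ℂ) • (((p : ℂ) • Matrix.single i j (1 : ℂ) + (q : ℂ) • Matrix.single j i (1 : ℂ)) * Matrix.diagonal ζ * ((p : ℂ) • Matrix.single i j (1 : ℂ) + (q : ℂ) • Matrix.single j i (1 : ℂ))) =
    (2 - 2 * C) • (Matrix.diagonal ζ * (Matrix.single i i (1 : ℂ) + Matrix.single j j (1 : ℂ))) + (2 * S) • (Matrix.diagonal ζ * (I • Matrix.single i i (1 : ℂ) - I • Matrix.single j j (1 : ℂ))) := by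
  have h : (p : ℂ) * q = 1 := by exact_mod_cast hpq
  simp only [add_mul, mul_add, mul_sub, Matrix.smul_mul, Matrix.mul_smul, smul_smul, single_mul_diagonal, diagonal_mul_single, Matrix.single_mul_single_same,
    Matrix.single_mul_single_of_ne, hij, hij.symm, ne_eq, not_false_eq_true, smul_zero, add_zero, zero_add, mul_one]
  linear_combination (norm := module) ((-2 : ℂ) • hb + (-2 * ζ j) • h) • Matrix.single i i (1 : ℂ) + ((-2 : ℂ) • ha + (-2 * ζ i) • h) • Matrix.single j j (1 : ℂ)

/-- COMPACT: `Xγ − γX = (C−1)•γX + (−S)•γY`. [cite: Varadarajan1989, §6.3] -/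
theorem Xc_mul_diagonal_sub : ((p : ℂ) • Matrix.single i j (1 : ℂ) - (q : ℂ) • Matrix.single j i (1 : ℂ)) * Matrix.diagonal ζ - Matrix.diagonal ζ * ((p : ℂ) • Matrix.single i j (1 : ℂ) - (q : ℂ) • Matrix.single j i (1 : ℂ)) = (C - 1) • (Matrix.diagonal ζ * ((p : ℂ) • Matrix.single i j (1 : ℂ) - (q : ℂ) • Matrix.single j i (1 : ℂ))) + (-S) • (Matrix.diagonal ζ * (((p : ℂ) * I) • Matrix.single i j (1 : ℂ) + ((q : ℂ) * I) • Matrix.single j i (1 : ℂ))) := by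
  simp only [sub_mul, mul_sub, mul_add, Matrix.smul_mul, Matrix.mul_smul, smul_smul, single_mul_diagonal, diagonal_mul_single]
  linear_combination (norm := module) ((p : ℂ) • hb) • Matrix.single i j (1 : ℂ) + ((-(q : ℂ)) • ha) • Matrix.single j i (1 : ℂ)

/-- COMPACT: `Yγ − γY = S•γX + (C−1)•γY`. [cite: Varadarajan1989, §6.3] -/
theorem Yc_mul_diagonal_sub : (((p : ℂ) * I) • Matrix.single i j (1 : ℂ) + ((q : ℂ) * I) • Matrix.single j i (1 : ℂ)) * Matrix.diagonal ζ - Matrix.diagonal ζ * (((p : ℂ) * I) • Matrix.single i j (1 : ℂ) + ((q : ℂ) * I) • Matrix.single j i (1 : ℂ)) = (-(-S)) • (Matrix.diagonal ζ * ((p : ℂ) • Matrix.single i j (1 : ℂ) - (q : ℂ) • Matrix.single j i (1 : ℂ))) + (C - 1) • (Matrix.diagonal ζ * (((p : ℂ) * I) • Matrix.single i j (1 : ℂ) + ((q : ℂ) * I) • Matrix.single j i (1 : ℂ))) := by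
  simp only [mul_sub, add_mul, mul_add, Matrix.smul_mul, Matrix.mul_smul, smul_smul, single_mul_diagonal, diagonal_mul_single]
  linear_combination (norm := module) (((p : ℂ) * I) • hb + (-((p : ℂ) * ζ i * (S : ℂ))) • I_sq) • Matrix.single i j (1 : ℂ) + (((q : ℂ) * I) • ha + ((q : ℂ) * ζ j * (S : ℂ)) • I_sq) • Matrix.single j i (1 : ℂ)

omit hb ha in
include hij hpq hb ha in
/-- COMPACT: `−(Pγ + γP) − 2•XγX = (2−2C)•(−γP) + (2(−S))•γH_ij` (`pq = 1`). [cite: Varadarajan1989, §6.3] -/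
theorem rotationJet_two_eq : -((Matrix.single i i (1 : ℂ) + Matrix.single j j (1 : ℂ)) * Matrix.diagonal ζ + Matrix.diagonal ζ * (Matrix.single i i (1 : ℂ) + Matrix.single j j (1 : ℂ))) - (2 : ℂ) • (((p : ℂ) • Matrix.single i j (1 : ℂ) - (q : ℂ) • Matrix.single j i (1 : ℂ)) * Matrix.diagonal ζ * ((p : ℂ) • Matrix.single i j (1 : ℂ) - (q : ℂ) • Matrix.single j i (1 : ℂ))) =
    (2 - 2 * C) • (-(Matrix.diagonal ζ * (Matrix.single i i (1 : ℂ) + Matrix.single j j (1 : ℂ)))) + (2 * (-S)) • (Matrix.diagonal ζ * (I • Matrix.single i i (1 : ℂ) - I • Matrix.single j j (1 : ℂ))) := by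
  have h : (p : ℂ) * q = 1 := by exact_mod_cast hpq
  simp only [add_mul, mul_add, mul_sub, sub_mul, Matrix.smul_mul, Matrix.mul_smul, smul_smul, single_mul_diagonal, diagonal_mul_single, Matrix.single_mul_single_same,
    Matrix.single_mul_single_of_ne, hij, hij.symm, ne_eq, not_false_eq_true, smul_zero, sub_zero, zero_sub, mul_one]
  linear_combination (norm := module) ((2 : ℂ) • hb + (2 * ζ j) • h) • Matrix.single i i (1 : ℂ) + ((2 : ℂ) • ha + (2 * ζ i) • h) • Matrix.single j j (1 : ℂ)

end Torus

end Literature.NumberTheory.Automorphic.RootVectors
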